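import Summits.QuantumFields.YangMills.Theorems.UnitScaleTiltProp7RTermFloor
import Summits.QuantumFields.YangMills.Theorems.UnitScaleTiltProp7CoarseGramCoercivity
import Summits.QuantumFields.YangMills.Theorems.UnitScaleTiltProp7ComplementaryProjectorColumns
import HarnessLib

/-!
# Route `UnitScaleTilt`, crux K1 «MinimiserStabilityRegPr» (stmt-QuantumFields-19200), EX row `hGF[Lift]` (curved member) — **LOD LINE, (L6): THE MEMBER DOCK OF THE
# `H¹` ABSORPTION OF THE DIVERGENCE, `‖D*_{U₀}A‖² ≤ ‖R_{Q″}(D*_{U₀}A)‖² + c_R·‖A‖²`** — slot (K2d) `hDst` of ✓`Prop7LODSlotK2.hK2_of_rows` (w5 g13, p754590) and the displayed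
# `hP1abs` row of ✓`Prop7LocalComparisonKnit.localComparison_of_cube` (routeR-w3 g12, p754654) ∕ ✓`…KnitBlockSet` (p756966) ∕ ✓`…CubeGauge` (routeR-w4 g26, p757454), read
# from ★p1's ABSTRACT theorem ✓`Prop7RTermFloor.normSq_adjoint_le_normSq_projR_add` (p750717) at the T³ member.

Cell `ym3-torus` (HUMAN RULING D-0037, YM ladder rung R3 — NOT d = 4, NOT infinite volume, NOT a mass gap, NOT Clay).  Width seat `ym-routeR-w4` gen 27 («MINE (K2d) `hDst` ∕
`hP1abs` member dock» 2026-08-30 03:06:53Z).  THEOREMS ONLY (0 `def`, 0 `sorry`); `--supports stmt-QuantumFields-19200 --as helper`, count-neutral.  HONEST LABEL (★★OWNER RULING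
№33 (6)): curved γ-row supplier line, (L6) assembly letters; a DOCK — the algebra is ★p1's ✓p750717, the coarse coercivity is px10 g9's ✓`coarseGram_coercive`, the
massive inverse is px5's ✓`exists_massive_inverse`, the kernel bridge is routeR-w2's ✓`ker_lift_comp_eq`; nothing of (3.49), Thm 3.1∕3.3∕3.11, `h349`, `hGF`, `hT`, `hK₂`, `hcmp`, EX ∕
19200 is proved here.

WHY A DOCK IS OWED.  ✓p750717 speaks of `Δ G D D† Q T` on abstract complex inner-product spaces with `Q : E →ₗ F` into an INNER-PRODUCT space `F` and the rows `hΔ hΔD hDad hT hAG hGA hm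
hcoer`; the member binders read `∀ A : BondL2K, ‖DstarL2 U₀ A‖² ≤ ‖projR (covLapSite U₀) Q″ (DstarL2 U₀ A)‖² + c_R·‖A‖²` with `Q″` valued in the BARE coarse function space
`Site (F.P K) (K−n) → M₂(ℂ)`.  The dock: (i) `Δ := covLapSite U₀ = DstarL2 U₀ ∘ₗ DL2 U₀` (`rfl`), `hΔD`∕`hDad` by ✓`adjoint_DL2`; (ii) `Q := ι ∘ₗ Q″` (routeR-w2's coarse reading into the
level-`n` `SiteL2K`, weight `c₁`), `T` its adjoint, and the BRIDGE `projR Δ (ι ∘ₗ Q″) = projR Δ Q″` (§1; `ker (ι ∘ₗ Q″) = ker Q″`, ✓`ker_lift_comp_eq`); (iii) `G := G_a` the massive inverse;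
(iv) `m := m_B = 2∕((1+s)(d_E²+a))` of ✓`coarseGram_coercive` at `RegPr` (`n < K`, `10⁷L³ε₀ ≤ 1`; `s = (25∕8)c₁∕(c₀(L^d)^{K−n})`, `d_E² = 600(27∕4)⁶c₀(L³)^{K−n}∕c₁`).

WHAT IS PROVED (ns `Summit.QuantumFields.YangMills.Theorems.Prop7DivergenceAbsorptionOfRegPr`).
* §1 ★ `projR_eq_of_ker_eq` (lit `projR Δ Q` depends on `Q` only through `ker Q`) · `projR_lift_comp_eq` (the bridge at the member).
* §2 ★★ `normSq_DstarL2_le_normSq_projR_add` — HYPOTHESIS FORM over routeR-w2's massive variable block VERBATIM (`Q'' ι hι T hT a G hAG hGA`) + (`hm`, `hcoer`), ANY background, no `RegPr`: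
  `‖D*_{U₀}A‖² ≤ ‖R_{Q″}(D*_{U₀}A)‖² + (m²a)⁻¹·‖A‖²` — `hDst` with `cR := (m²a)⁻¹`.
* §3 ★★★ `normSq_DstarL2_le_normSq_projR_add_of_regPr` — at `RegPr F n K ε₀ U₀` with `m := m_B` DISCHARGED (px10); ★★★ `normSq_DstarL2_le_normSq_projR_add_of_regPr'` — the `∃`-FREE reading:
  `ι`, `T := (ι ∘ₗ Q″)†`, `G` are obtained inside (✓`exists_massive_inverse`), displayed: `Q″` + `hseq` (clause (iv) of ✓`exists_intertwiner_of_regPr`), `0 < a`, the coarse weight `c₁`.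
* §4 ★★ `normSq_DstarL2_one_le_normSq_projR_add` — the `U₀ = 1` reading (lit ✓`regPr_one`; NO regularity letter displayed) = routeR-w3's `hP1abs` letter for EVERY bond field, and
  ★ `hP1abs_of_hseq` — the same at
  `Ỹ := (Ad_σX)~ = toL2 (b ↦ σ(b₋)X(b)σ(b₋)*)`, i.e. the `hP1abs` binder of ✓`localComparison_of_cube[_blockSet∕_cubeGauge]` TOKEN FOR TOKEN with `c₆ := (m_B²·a)⁻¹`.
CONSTANT (honest): at the chair's pin `c₁ = c₀L^{3(K−n)}` one has `s = 25∕8`, `d_E² = 600(27∕4)⁶`, so `c_R = (33∕16)²(600(27∕4)⁶ + a)²∕a`, minimised at the massive weight `a = d_E²`: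
`c_R = (33∕16)²·4·600(27∕4)⁶ ≈ 9.8·10⁸` — K- and volume-FREE but LARGE; the massive weight `a` here is FREE (the projector `R_{Q″}` does not depend on it) and is NOT the LOD coupling
`a₀(c₀∕cB)(L^{K−n})³`; the window bookkeeping `γ_LOD > 0` of ✓`curvedTarget_of_LOD_topMean` is the assembler's and is NOT touched here.

References: T. Bałaban, CMP **99** (1985) 389–434 [Balaban1985BackgroundPropagators] ((3.8) p.392, (3.16) p.393, (3.20)–(3.27) pp.394–395, Thm 3.11 p.416); CMP **98** (1985) 17–51
[Balaban1985Averaging] ((97) p.32).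
-/

set_option autoImplicit false

noncomputable section

open scoped BigOperators Matrix.Norms.L2Operator InnerProductSpace ComplexConjugate

namespace Summit.QuantumFields.YangMills.Theorems.Prop7DivergenceAbsorptionOfRegPr

open Literature.MathematicalPhysics.QuantumFieldTheory.Balaban1983to89
open Literature.MathematicalPhysics.QuantumFieldTheory.Balaban1983to89.T3ContinuumYM3Torus
open T4Continuum BlockAveraging
open BlockAveraging (Idx)
open B7Prop1Explicit (disp)
open B10Eq27TorusAxialLog (holT transl)
open B7TransferAnalyticMean (meanCLM)
open B11Eq103H1Complex (SiteL2K BondL2K projR)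
open Summit.QuantumFields.YangMills.Theorems.Prop8Chart (emlIterU)
open T3SectALandauChart (eta eta_pos bgUnits)
open T3PrintedRegularMinimiser (RegPr regPr_one)
open T3PrintedRegularOrbits (sites_eq)
open T3LevelShift (siteShift)
open Summit.QuantumFields.YangMills.Theorems.Prop7SectET3Transport (periodsT3)
open Summit.QuantumFields.YangMills.Theorems.Prop7SectET3HilbertLetters (W₂ toL2 toL2S DL2 DstarL2 covLapSite adjoint_DL2)
open Summit.QuantumFields.YangMills.Theorems.Prop7RTermFloor (normSq_adjoint_le_normSq_projR_add)
open Summit.QuantumFields.YangMills.Theorems.Prop7CoarseGramCoercivity (coarseGram_coercive)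
open Summit.QuantumFields.YangMills.Theorems.Prop7MassivePropagatorCoercive (exists_massive_inverse)
open Summit.QuantumFields.YangMills.Theorems.Prop7ComplementaryProjectorColumns (ker_lift_comp_eq)
open Summit.QuantumFields.YangMills.Theorems.Prop7CovLapSiteEntryRows (isSymmetric_covLapSite inner_covLapSite_eq_inner_DL2)

/-! ## §1 The bridge: `projR Δ Q` depends on `Q` only through `ker Q` -/

section Bridge

variable {E : Type*} [NormedAddCommGroup E] [InnerProductSpace ℂ E] [FiniteDimensional ℂ E]
  {F₁ F₂ : Type*} [AddCommGroup F₁] [Module ℂ F₁] [AddCommGroup F₂] [Module ℂ F₂]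

/-- ★ **lit `projR Δ Q` depends on `Q` only through its kernel**: `ker Q₁ = ker Q₂ ⟹ projR Δ Q₁ = projR Δ Q₂` (both are the orthogonal projection onto `Δ·ker`).
[cite: Balaban1985BackgroundPropagators, (3.20)–(3.21) p.394] -/
theorem projR_eq_of_ker_eq (Δ : E →ₗ[ℂ] E) (Q₁ : E →ₗ[ℂ] F₁) (Q₂ : E →ₗ[ℂ] F₂) (hker : LinearMap.ker Q₁ = LinearMap.ker Q₂) :
    projR Δ Q₁ = projR Δ Q₂ := by
  -- `HasOrthogonalProjection` is a `Prop`: the two instances over equal submodules are definitionally equal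
  have key : ∀ (p₁ p₂ : Submodule ℂ E), p₁ = p₂ → ∀ (i₁ : p₁.HasOrthogonalProjection) (i₂ : p₂.HasOrthogonalProjection),
      ((@Submodule.starProjection ℂ E _ _ _ p₁ i₁ : E →L[ℂ] E) : E →ₗ[ℂ] E) = ((@Submodule.starProjection ℂ E _ _ _ p₂ i₂ : E →L[ℂ] E) : E →ₗ[ℂ] E) := by
    rintro p₁ _ rfl i₁ i₂
    rfl
  unfold projR
  exact key _ _ (by rw [hker]) _ _

end Bridge

variable (F : T3Family) {n K : ℕ} (h : n ≤ K) {c₀ c₁ : ℝ} [Fact (0 < c₀)] [Fact (0 < c₁)]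
  {ε₀ : ℝ} (hε₀ : 0 < ε₀) (hε7 : 10 ^ 7 * (F.L : ℝ) ^ 3 * ε₀ ≤ 1)
  (U₀ : GaugeField (F.P K) 0 (Matrix.specialUnitaryGroup (Fin 2) ℂ)) (hreg : RegPr F n K ε₀ U₀)
  (Q'' : SiteL2K ℂ 3 (periodsT3 F K) c₀ W₂ →ₗ[ℂ] (Site (F.P K) (K - n) → Matrix (Fin 2) (Fin 2) ℂ))
  (hseq : ∀ lam : Site (F.P K) 0 → Matrix (Fin 2) (Fin 2) ℂ, ∃ ns : (j : ℕ) → Site (F.P K) j → Matrix (Fin 2) (Fin 2) ℂ, ns 0 = lam ∧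
      (∀ (j : ℕ) (y : Site (F.P K) (j + 1)), ns (j + 1) y = ns j (emb y) - meanCLM (Idx (F.P K)) (Matrix (Fin 2) (Fin 2) ℂ) fun i : Idx (F.P K) =>
        ns j (emb y) - ((holT (emlIterU j (bgUnits F K U₀)) (emb y) (stairWord i.2.1 (off i.1)) : (Matrix (Fin 2) (Fin 2) ℂ)ˣ) : Matrix (Fin 2) (Fin 2) ℂ) *
          ns j (transl (emb y) (disp (stairWord i.2.1 (off i.1)))) * (((holT (emlIterU j (bgUnits F K U₀)) (emb y) (stairWord i.2.1 (off i.1)))⁻¹ : (Matrix (Fin 2) (Fin 2) ℂ)ˣ) : Matrix (Fin 2) (Fin 2) ℂ)) ∧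
      ns (K - n) = Q'' (toL2S F K c₀ lam))
  (ι : (Site (F.P K) (K - n) → Matrix (Fin 2) (Fin 2) ℂ) →ₗ[ℂ] SiteL2K ℂ 3 (periodsT3 F n) c₁ W₂)
  (hι : ∀ c, ι c = toL2S F n c₁ (fun z => c (siteShift (sites_eq F n K h) z)))
  (T : SiteL2K ℂ 3 (periodsT3 F n) c₁ W₂ →ₗ[ℂ] SiteL2K ℂ 3 (periodsT3 F K) c₀ W₂)
  (hT : ∀ (l : SiteL2K ℂ 3 (periodsT3 F K) c₀ W₂) (f : SiteL2K ℂ 3 (periodsT3 F n) c₁ W₂), ⟪ι (Q'' l), f⟫_ℂ = ⟪l, T f⟫_ℂ)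
  {a : ℝ} (ha : 0 < a)
  (G : SiteL2K ℂ 3 (periodsT3 F K) c₀ W₂ →ₗ[ℂ] SiteL2K ℂ 3 (periodsT3 F K) c₀ W₂)
  (hAG : ∀ f, covLapSite F n K c₀ U₀ (G f) + (a : ℂ) • T (ι (Q'' (G f))) = f)
  (hGA : ∀ u, G (covLapSite F n K c₀ U₀ u + (a : ℂ) • T (ι (Q'' u))) = u)

include hι in
omit [Fact (0 < c₁)] in
/-- **THE BRIDGE AT THE MEMBER**: `projR (covLapSite U₀) (ι ∘ₗ Q″) = projR (covLapSite U₀) Q″` — the coarse reading `ι` is injective (✓`ker_lift_comp_eq`).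
[cite: Balaban1985BackgroundPropagators, (3.16) p.393, (3.20)–(3.21) p.394] -/
theorem projR_lift_comp_eq :
    projR (covLapSite F n K c₀ U₀) (ι ∘ₗ Q'') = projR (covLapSite F n K c₀ U₀) Q'' :=
  projR_eq_of_ker_eq _ _ _ (ker_lift_comp_eq F h Q'' ι hι)

/-! ## §2 Hypothesis form: any background, routeR-w2's massive variable block + the coarse coercivity row -/

include hι hT ha hAG hGA in
/-- ★★ **THE `H¹` ABSORPTION OF THE DIVERGENCE AT THE MEMBER, HYPOTHESIS FORM** (any background `U₀`; the massive data `Q″ ι T a G` of routeR-w2's B-files and a coarse coercivity row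
`m‖f‖ ≤ ‖G(Tf)‖`, `0 < m`): for every vector field `A`,
**`‖DstarL2 U₀ A‖² ≤ ‖projR (covLapSite U₀) Q″ (DstarL2 U₀ A)‖² + (m²a)⁻¹·‖A‖²`** — ★p1's ✓`normSq_adjoint_le_normSq_projR_add` at `Δ := covLapSite U₀ = D†D` (✓`adjoint_DL2`), `Q := ι ∘ₗ Q″`,
through the bridge of §1.  (`hDst` of ✓`hK2_of_rows` with `cR := (m²a)⁻¹`.) [cite: Balaban1985BackgroundPropagators, (3.21)–(3.27) pp.394–395, Thm 3.11 p.416] -/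
theorem normSq_DstarL2_le_normSq_projR_add {m : ℝ} (hm : 0 < m) (hcoer : ∀ f : SiteL2K ℂ 3 (periodsT3 F n) c₁ W₂, m * ‖f‖ ≤ ‖G (T f)‖)
    (A : BondL2K ℂ 3 (periodsT3 F K) c₀ W₂) :
    ‖DstarL2 F n K c₀ U₀ A‖ ^ 2 ≤ ‖projR (covLapSite F n K c₀ U₀) Q'' (DstarL2 F n K c₀ U₀ A)‖ ^ 2 + (m ^ 2 * a)⁻¹ * ‖A‖ ^ 2 := by
  have hΔ : ∀ x y : SiteL2K ℂ 3 (periodsT3 F K) c₀ W₂, ⟪covLapSite F n K c₀ U₀ x, y⟫_ℂ = ⟪x, covLapSite F n K c₀ U₀ y⟫_ℂ :=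
    fun x y => isSymmetric_covLapSite F U₀ x y
  have hΔD : ∀ v w : SiteL2K ℂ 3 (periodsT3 F K) c₀ W₂, ⟪covLapSite F n K c₀ U₀ v, w⟫_ℂ = ⟪DL2 F n K c₀ U₀ v, DL2 F n K c₀ U₀ w⟫_ℂ := by
    intro v w
    rw [hΔ, inner_covLapSite_eq_inner_DL2]
  have hDad : ∀ (v : SiteL2K ℂ 3 (periodsT3 F K) c₀ W₂) (B : BondL2K ℂ 3 (periodsT3 F K) c₀ W₂), ⟪DL2 F n K c₀ U₀ v, B⟫_ℂ = ⟪v, DstarL2 F n K c₀ U₀ B⟫_ℂ := by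
    intro v B
    rw [← adjoint_DL2, LinearMap.adjoint_inner_right]
  have hT' : ∀ (l : SiteL2K ℂ 3 (periodsT3 F K) c₀ W₂) (c : SiteL2K ℂ 3 (periodsT3 F n) c₁ W₂), ⟪(ι ∘ₗ Q'') l, c⟫_ℂ = ⟪l, T c⟫_ℂ :=
    fun l c => hT l c
  have hAG' : ∀ v, (covLapSite F n K c₀ U₀ + (a : ℂ) • (T ∘ₗ (ι ∘ₗ Q''))) (G v) = v := fun v => by
    show covLapSite F n K c₀ U₀ (G v) + (a : ℂ) • T (ι (Q'' (G v))) = v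
    exact hAG v
  have hGA' : ∀ v, G ((covLapSite F n K c₀ U₀ + (a : ℂ) • (T ∘ₗ (ι ∘ₗ Q''))) v) = v := fun v => by
    show G (covLapSite F n K c₀ U₀ v + (a : ℂ) • T (ι (Q'' v))) = v
    exact hGA v
  have key := normSq_adjoint_le_normSq_projR_add (covLapSite F n K c₀ U₀) G (DL2 F n K c₀ U₀) (DstarL2 F n K c₀ U₀) (ι ∘ₗ Q'') T
    hΔ hΔD hDad hT' ha hAG' hGA' hm hcoer A
  rw [projR_lift_comp_eq F h U₀ Q'' ι hι] at key
  rw [inv_mul_eq_div]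
  exact key

/-! ## §3 At `RegPr`: the coarse coercivity discharged by px10's ✓`coarseGram_coercive`; and the `∃`-free reading -/

include hε₀ hε7 hreg hseq hι hT ha hAG hGA in
/-- ★★★ **THE `H¹` ABSORPTION OF THE DIVERGENCE AT `RegPr`, COERCIVITY DISCHARGED**: for `n < K`, `10⁷L³ε₀ ≤ 1`, `U₀ ∈ 𝔘_k(ε₀)` and the massive data of routeR-w2's B-files,
**`‖DstarL2 U₀ A‖² ≤ ‖projR (covLapSite U₀) Q″ (DstarL2 U₀ A)‖² + (m_B²·a)⁻¹·‖A‖²`**, `m_B = 2∕((1+s)(d_E²+a))` (✓`coarseGram_coercive`).  (`hDst` with `cR := (m_B²a)⁻¹`.)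
[cite: Balaban1985BackgroundPropagators, (3.21)–(3.27) pp.394–395, Thm 3.11 p.416; Balaban1985Averaging, (97) p.32] -/
theorem normSq_DstarL2_le_normSq_projR_add_of_regPr (hnK : n < K) (A : BondL2K ℂ 3 (periodsT3 F K) c₀ W₂) :
    ‖DstarL2 F n K c₀ U₀ A‖ ^ 2 ≤ ‖projR (covLapSite F n K c₀ U₀) Q'' (DstarL2 F n K c₀ U₀ A)‖ ^ 2
      + ((2 / ((1 + (25 / 8) * (c₁ * ((((F.P K).L : ℝ) ^ (F.P K).d) ^ (K - n))⁻¹ / c₀)) * (600 * (27 / 4 : ℝ) ^ 6 * (c₀ * ((F.L : ℝ) ^ 3) ^ (K - n) / c₁) + a))) ^ 2 * a)⁻¹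
        * ‖A‖ ^ 2 := by
  have hc₀ : 0 < c₀ := Fact.out
  have hc₁ : 0 < c₁ := Fact.out
  have hm : 0 < 2 / ((1 + (25 / 8) * (c₁ * ((((F.P K).L : ℝ) ^ (F.P K).d) ^ (K - n))⁻¹ / c₀)) * (600 * (27 / 4 : ℝ) ^ 6 * (c₀ * ((F.L : ℝ) ^ 3) ^ (K - n) / c₁) + a)) := by
    positivity
  exact normSq_DstarL2_le_normSq_projR_add F h U₀ Q'' ι hι T hT ha G hAG hGA hm (coarseGram_coercive F hnK h hε₀ hε7 U₀ hreg Q'' hseq ι hι T hT ha G hAG) A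

include hε₀ hε7 hreg hseq in
/-- ★★★ **THE `∃`-FREE READING** (what the (L6) assembler wants when no massive data is in scope): for `n < K`, `10⁷L³ε₀ ≤ 1`, `U₀ ∈ 𝔘_k(ε₀)`, an averaging-of-record map `Q″` with clause (iv)
(`hseq`), any massive weight `0 < a` and any coarse weight `c₁ > 0`:
**`‖DstarL2 U₀ A‖² ≤ ‖projR (covLapSite U₀) Q″ (DstarL2 U₀ A)‖² + (m_B²·a)⁻¹·‖A‖²`** for every `A` — the coarse reading `ι`, the adjoint `T := (ι ∘ₗ Q″)†` and the massive inverse `G`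
(✓`exists_massive_inverse`) are obtained inside. [cite: Balaban1985BackgroundPropagators, (3.16) p.393, (3.21)–(3.27) pp.394–395, Thm 3.11 p.416; Balaban1985Averaging, (97) p.32] -/
theorem normSq_DstarL2_le_normSq_projR_add_of_regPr' (hnK : n < K) (c₁' : ℝ) (hc₁' : 0 < c₁') {a' : ℝ} (ha' : 0 < a')
    (A : BondL2K ℂ 3 (periodsT3 F K) c₀ W₂) :
    ‖DstarL2 F n K c₀ U₀ A‖ ^ 2 ≤ ‖projR (covLapSite F n K c₀ U₀) Q'' (DstarL2 F n K c₀ U₀ A)‖ ^ 2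
      + ((2 / ((1 + (25 / 8) * (c₁' * ((((F.P K).L : ℝ) ^ (F.P K).d) ^ (K - n))⁻¹ / c₀)) * (600 * (27 / 4 : ℝ) ^ 6 * (c₀ * ((F.L : ℝ) ^ 3) ^ (K - n) / c₁') + a'))) ^ 2 * a')⁻¹
        * ‖A‖ ^ 2 := by
  haveI : Fact (0 < c₁') := ⟨hc₁'⟩
  -- the coarse reading `ι` (transport to the level-`n` lattice + `toL2S`), as a linear map
  obtain ⟨ι', hι'⟩ : ∃ ι' : (Site (F.P K) (K - n) → Matrix (Fin 2) (Fin 2) ℂ) →ₗ[ℂ] SiteL2K ℂ 3 (periodsT3 F n) c₁' W₂,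
      ∀ c, ι' c = toL2S F n c₁' (fun z => c (siteShift (sites_eq F n K hnK.le) z)) :=
    ⟨(toL2S F n c₁').toLinearMap ∘ₗ LinearMap.funLeft ℂ (Matrix (Fin 2) (Fin 2) ℂ) (siteShift (sites_eq F n K hnK.le)), fun c => rfl⟩
  -- the adjoint of `ι ∘ Q″` (finite dimension)
  obtain ⟨T', hT'⟩ : ∃ T' : SiteL2K ℂ 3 (periodsT3 F n) c₁' W₂ →ₗ[ℂ] SiteL2K ℂ 3 (periodsT3 F K) c₀ W₂,
      ∀ (l : SiteL2K ℂ 3 (periodsT3 F K) c₀ W₂) (f : SiteL2K ℂ 3 (periodsT3 F n) c₁' W₂), ⟪ι' (Q'' l), f⟫_ℂ = ⟪l, T' f⟫_ℂ :=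
    ⟨LinearMap.adjoint (ι' ∘ₗ Q''), fun l f => by rw [LinearMap.adjoint_inner_right, LinearMap.comp_apply]⟩
  -- the massive inverse
  obtain ⟨G', hAG', hGA', -⟩ := exists_massive_inverse F hnK.le hε₀ hε7 U₀ hreg Q'' hseq ι' hι' T' hT' ha'
  exact normSq_DstarL2_le_normSq_projR_add_of_regPr F hnK.le hε₀ hε7 U₀ hreg Q'' hseq ι' hι' T' hT' ha' G' hAG' hGA' hnK A

/-! ## §4 The `U₀ = 1` reading: routeR-w3's `hP1abs` -/

/-- ★★ **THE FLAT READING (`U₀ = 1`)**: for `n < K`, an averaging-of-record map `Qf` at the trivial background with clause (iv) (`hseq` at `bgUnits F K 1`; the curried clause of the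
knit converts by ✓`Prop7PTermLocalGaugeKnit.hseq_of_htop`), any massive weight `0 < a`, any coarse weight `0 < c₁` — NO regularity letter displayed (`U₀ = 1 ∈ 𝔘_k(ε)` for every
`ε > 0`, lit ✓`regPr_one`; the window `10⁷L³ε ≤ 1` is met at `ε := (10⁷L³)⁻¹` inside):
**`‖DstarL2 1 B‖² ≤ ‖projR (covLapSite 1) Qf (DstarL2 1 B)‖² + (m_B²·a)⁻¹·‖B‖²`** for every bond field `B`. [cite: Balaban1985BackgroundPropagators, (3.21)–(3.27) pp.394–395, Thm 3.11 p.416] -/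
theorem normSq_DstarL2_one_le_normSq_projR_add (hnK : n < K)
    (Qf : SiteL2K ℂ 3 (periodsT3 F K) c₀ W₂ →ₗ[ℂ] (Site (F.P K) (K - n) → Matrix (Fin 2) (Fin 2) ℂ))
    (hseqf : ∀ lam : Site (F.P K) 0 → Matrix (Fin 2) (Fin 2) ℂ, ∃ ns : (j : ℕ) → Site (F.P K) j → Matrix (Fin 2) (Fin 2) ℂ, ns 0 = lam ∧
      (∀ (j : ℕ) (y : Site (F.P K) (j + 1)), ns (j + 1) y = ns j (emb y) - meanCLM (Idx (F.P K)) (Matrix (Fin 2) (Fin 2) ℂ) fun i : Idx (F.P K) =>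
        ns j (emb y) - ((holT (emlIterU j (bgUnits F K (1 : GaugeField (F.P K) 0 (Matrix.specialUnitaryGroup (Fin 2) ℂ)))) (emb y) (stairWord i.2.1 (off i.1)) : (Matrix (Fin 2) (Fin 2) ℂ)ˣ) : Matrix (Fin 2) (Fin 2) ℂ) *
          ns j (transl (emb y) (disp (stairWord i.2.1 (off i.1)))) *
          (((holT (emlIterU j (bgUnits F K (1 : GaugeField (F.P K) 0 (Matrix.specialUnitaryGroup (Fin 2) ℂ)))) (emb y) (stairWord i.2.1 (off i.1)))⁻¹ : (Matrix (Fin 2) (Fin 2) ℂ)ˣ) : Matrix (Fin 2) (Fin 2) ℂ)) ∧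
      ns (K - n) = Qf (toL2S F K c₀ lam))
    (c₁' : ℝ) (hc₁' : 0 < c₁') {a' : ℝ} (ha' : 0 < a') (B : BondL2K ℂ 3 (periodsT3 F K) c₀ W₂) :
    ‖DstarL2 F n K c₀ (1 : GaugeField (F.P K) 0 (Matrix.specialUnitaryGroup (Fin 2) ℂ)) B‖ ^ 2
      ≤ ‖projR (covLapSite F n K c₀ (1 : GaugeField (F.P K) 0 (Matrix.specialUnitaryGroup (Fin 2) ℂ))) Qf
            (DstarL2 F n K c₀ (1 : GaugeField (F.P K) 0 (Matrix.specialUnitaryGroup (Fin 2) ℂ)) B)‖ ^ 2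
        + ((2 / ((1 + (25 / 8) * (c₁' * ((((F.P K).L : ℝ) ^ (F.P K).d) ^ (K - n))⁻¹ / c₀)) * (600 * (27 / 4 : ℝ) ^ 6 * (c₀ * ((F.L : ℝ) ^ 3) ^ (K - n) / c₁') + a'))) ^ 2 * a')⁻¹
          * ‖B‖ ^ 2 := by
  -- the trivial background is regular at every `ε > 0`; take `ε := (10⁷L³)⁻¹`
  have hL : (0 : ℝ) < F.L := by have := F.hL.2; exact_mod_cast (by omega : 0 < F.L)
  have hε : (0 : ℝ) < (10 ^ 7 * (F.L : ℝ) ^ 3)⁻¹ := by positivity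
  have hε7 : 10 ^ 7 * (F.L : ℝ) ^ 3 * (10 ^ 7 * (F.L : ℝ) ^ 3)⁻¹ ≤ 1 := (mul_inv_cancel₀ (by positivity)).le
  exact normSq_DstarL2_le_normSq_projR_add_of_regPr' F hε hε7 1 (regPr_one hε) Qf hseqf hnK c₁' hc₁' ha' B

/-- ★ **routeR-w3's `hP1abs` BINDER, TOKEN FOR TOKEN** (✓`localComparison_of_cube` ∕ `…_blockSet` ∕ `…_cubeGauge`), at `Ỹ := toL2 (b ↦ σ(b₋)·X(b)·σ(b₋)*)` with
`c₆ := (m_B²·a)⁻¹`: §4 at that bond field. [cite: Balaban1985BackgroundPropagators, (3.21)–(3.27) pp.394–395, Thm 3.11 p.416] -/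
theorem hP1abs_of_hseq (hnK : n < K)
    (Qf : SiteL2K ℂ 3 (periodsT3 F K) c₀ W₂ →ₗ[ℂ] (Site (F.P K) (K - n) → Matrix (Fin 2) (Fin 2) ℂ))
    (hseqf : ∀ lam : Site (F.P K) 0 → Matrix (Fin 2) (Fin 2) ℂ, ∃ ns : (j : ℕ) → Site (F.P K) j → Matrix (Fin 2) (Fin 2) ℂ, ns 0 = lam ∧
      (∀ (j : ℕ) (y : Site (F.P K) (j + 1)), ns (j + 1) y = ns j (emb y) - meanCLM (Idx (F.P K)) (Matrix (Fin 2) (Fin 2) ℂ) fun i : Idx (F.P K) =>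
        ns j (emb y) - ((holT (emlIterU j (bgUnits F K (1 : GaugeField (F.P K) 0 (Matrix.specialUnitaryGroup (Fin 2) ℂ)))) (emb y) (stairWord i.2.1 (off i.1)) : (Matrix (Fin 2) (Fin 2) ℂ)ˣ) : Matrix (Fin 2) (Fin 2) ℂ) *
          ns j (transl (emb y) (disp (stairWord i.2.1 (off i.1)))) *
          (((holT (emlIterU j (bgUnits F K (1 : GaugeField (F.P K) 0 (Matrix.specialUnitaryGroup (Fin 2) ℂ)))) (emb y) (stairWord i.2.1 (off i.1)))⁻¹ : (Matrix (Fin 2) (Fin 2) ℂ)ˣ) : Matrix (Fin 2) (Fin 2) ℂ)) ∧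
      ns (K - n) = Qf (toL2S F K c₀ lam))
    (c₁' : ℝ) (hc₁' : 0 < c₁') {a' : ℝ} (ha' : 0 < a')
    (σ : GaugeTransf (F.P K) 0 (Matrix.specialUnitaryGroup (Fin 2) ℂ)) (X : PBond (F.P K) 0 → Matrix (Fin 2) (Fin 2) ℂ) :
    ‖DstarL2 F n K c₀ 1 (toL2 F K c₀ (fun b => ((σ b.src : Matrix.specialUnitaryGroup (Fin 2) ℂ) : Matrix (Fin 2) (Fin 2) ℂ) * X b * star ((σ b.src : Matrix.specialUnitaryGroup (Fin 2) ℂ) : Matrix (Fin 2) (Fin 2) ℂ)))‖ ^ 2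
      ≤ ‖projR (covLapSite F n K c₀ 1) Qf (DstarL2 F n K c₀ 1 (toL2 F K c₀ (fun b => ((σ b.src : Matrix.specialUnitaryGroup (Fin 2) ℂ) : Matrix (Fin 2) (Fin 2) ℂ) * X b * star ((σ b.src : Matrix.specialUnitaryGroup (Fin 2) ℂ) : Matrix (Fin 2) (Fin 2) ℂ))))‖ ^ 2
        + ((2 / ((1 + (25 / 8) * (c₁' * ((((F.P K).L : ℝ) ^ (F.P K).d) ^ (K - n))⁻¹ / c₀)) * (600 * (27 / 4 : ℝ) ^ 6 * (c₀ * ((F.L : ℝ) ^ 3) ^ (K - n) / c₁') + a'))) ^ 2 * a')⁻¹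
          * ‖toL2 F K c₀ (fun b => ((σ b.src : Matrix.specialUnitaryGroup (Fin 2) ℂ) : Matrix (Fin 2) (Fin 2) ℂ) * X b * star ((σ b.src : Matrix.specialUnitaryGroup (Fin 2) ℂ) : Matrix (Fin 2) (Fin 2) ℂ))‖ ^ 2 :=
  normSq_DstarL2_one_le_normSq_projR_add F hnK Qf hseqf c₁' hc₁' ha' _

end Summit.QuantumFields.YangMills.Theorems.Prop7DivergenceAbsorptionOfRegPr

end
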